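import Summits.AtomisticToContinuum.HydrodynamicLimit.Theses.JParityClosure
import Summits.AtomisticToContinuum.HydrodynamicLimit.Theorems.LocalSecondLaw.Negative.Functional

/-!
# Line `kinetic-supersolution-kn-budget` — checked skeleton for the crux `LocalSecondLaw`
(stmt-AtomisticToContinuum-13081, route JParityClosure, rank 5)

crux-plan seat `planner-cruxplan-stmt-AtomisticToContinuum-13081-kinetic-supersolutio-0`, 2026-08-16.
Idea card `Cruxes/LocalSecondLaw/Ideas/kinetic-supersolution-kn-budget.md` (ideator 1; triage r1: pass ×3 —
TRIAGE-r1-1 §(M),(S) + sharpenings (1)–(4), TRIAGE-r1-2 "fixed-r rock", TRIAGE-r1-3 §1 + sharpenings (i)–(iii), all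
acted on below); line card `Lines/kinetic-supersolution-kn-budget.md`.

## The line in one identity

Let `h = h^N_{r,ϑ}` be the cone-in-space / Gaussian-in-velocity mollification of the empirical one-particle measure
(`hm`, verbatim the `hm` of `OddContactSymmetry`), `h_K = ∫ h log h dv` its Boltzmann `H`-density (`hK`),
`j_K = ∫ v h log h dv` its flux (`jK`), and
`h_kin := h_K + c₀ρ_r + ρ_r f_ex(ρ_r σ³)` (`hKin`, `c₀ = (3/2)(1 + log 2π)`) the Résibois/RET `H`-density of the
mollified empirical law — the COMPARISON FUNCTION of the line for the crux's thermodynamic entropy density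
`H(ρ_r, θ_r) = ρ_r log ρ_r − (3/2)ρ_r log θ_r + ρ_r f_ex(ρ_r σ³)` (`Hs`, guard included).  Gibbs' variational
principle at fixed `(ρ_r, m_r, e_r)` gives POINTWISE `h_kin − H(ρ_r,θ_r) = KL(h ‖ M[h]) − (3/2)ρ_r log(1 + ϑ²/θ_r)`
(the velocity kernel heats `h` to `θ_r + ϑ²`: triage r1-1 (1), r1-3 (ii) — the cold-spot term is carried, not ignored).
Along every good hard-sphere trajectory the localised kinetic `H`, `Λ(s) = ∫ φ(s,x) h_K dx`, is piecewise `C¹` with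
jumps at the collision times, and the fundamental theorem of calculus with jumps gives the EXACT weak-form balance

  `𝒲[h_K, j_K](z) = P(z) + C_ϑ(z)`,   `P(z) := ∑_{collisions s ∈ (0,τ]} [Λ(s, pre) − Λ(s, post)]`  (`collisionProduction`),

`C_ϑ = −ϑ² ∫₀^τ∫∫ φ ∇ᵥlog h · ∇ₓh` the free-streaming commutator of the velocity mollification
(`freeFlightRemainder := 𝒲[h_K,j_K] − P`).  `P` is the kinetic entropy PRODUCED AT COLLISIONS, localised by `φ` — the
SMEARED two-point surprisal jump (triage r1-1 (3): the literal collision term of `d/ds ∫∫ φ h log h`, so that the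
reduction below is an identity for ALL `τ`, shocks included; the card's one-point statistic `ε⁻¹K_N[φ F]` is its
MD-measurable proxy, equal to `P` up to the Résibois offset — foreseen layer 2, see the line card).  Adding the
configurational weak form `𝒲_C := 𝒲[ρ_r f_ex, ρ_r f_ex u_r]` (`WC`; no derivative of the bare-`limsup` EOS is ever
taken) and the exact continuity equation of the cone fields, the crux functional splits IDENTICALLY on `Φ.good`
(stub S1, `WeakFormLedger`):

  `I(z) + ∫ H(ρ_E(0),θ_E(0)) φ(0) = [P + 𝒲_C] + C_ϑ + ∫∫ (H(ρ_r,θ_r) − h_kin) ∂ₛφ + ∫∫ (H(ρ_r,θ_r) u_r − j_kin)·∇φ`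
  `                                 + [∫ H(ρ_E(0),θ_E(0)) φ(0) − ∫ h_kin(z) φ(0)]`
  `        =  netProduction + freeFlightRemainder + maxwellGap + fluxGap + initialGap`.

So `LocalSecondLaw` (the event `{I + init < −η}` is improbable, `N → ∞` at fixed `r`, then `r → 0`) follows by a
union bound from: S6 `netProduction ≥ −η/5` w.h.p. (THE BET: the localised empirical `H`-theorem at order `Kn`
— kinetic entropy produced at collisions plus configurational entropy change is asymptotically non-negative), and
the two-sided smallness of the four bookkeeping terms S2–S5, each in probability in the line's frame
`N → ∞` at fixed `(r, ϑ)`, then `ϑ → 0`, then `r → 0` (`EventuallyImprobable[E]`; `ϑ` is internal to the line and is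
eliminated in `LocalSecondLaw_of`).  The composition `LocalSecondLaw_of : LocalSecondLaw` is kernel-checked
(quantifier bookkeeping + `localGibbsLaw(Φ.goodᶜ) = 0` + sub-additivity); `sorry` only inside the six `stub_*`.

## Stubs (registered; `sorry` only inside them) — hardest: `stub_localNetProduction`

* S1 `stub_weakFormLedger` (provable now, M): the pathwise identity above on `Φ.good` — integrability of every
  space–time integrand along a hard-sphere trajectory (finitely many jumps on `[0,τ]`; Disproof junk audit), the
  exact weak continuity equation `∂ₛρ_r + div m_r = 0` of the translation-covariant cone kernel (kills the `c₀ρ_r`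
  part; only `φ` is differentiated), `ρ_r u_r = m_r` incl. the crux's junk `0/0 = 0`, `Φ₀ = id` on `good`, and the
  vanishing of the `s = τ` boundary term (`φ(s,·) = 0` for `s ≥ τ'`: honours `localSecondLaw_false_without_support`).
* S2 `stub_freeFlightRemainder` (L): `|𝒲[h_K,j_K] − P| ≤ η` w.h.p. — on `Φ.good` it IS the commutator `C_ϑ`
  (FTC with jumps + `(v−vᵢ)G_ϑ = −ϑ²∇G_ϑ` + IBP in `v`, the S1-type calculus = the card's `EmpiricalHBalance`), of
  size `O(ϑ²/(r√θ_*))` (mean field, where the local velocity law has spread `≥ √θ_* ≫ ϑ`) `+ O(1/(N r⁴ϑ²))`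
  (sampling); the sampling part and velocity moments are controlled under the EVOLVED law by the entropy inequality
  w.r.t. the invariant Gibbs measure (`H(μ^N_s | G_N) = H(μ^N_0 | G_N) = O(N)`), the mean-field part needs a
  TEMPERATURE FLOOR IN MEASURE (on a cold beam of spread `≪ ϑ` the commutator saturates at `−∫φ ρ div u = O(1)`)
  — the one dynamical input of S2, shared with S3(b); no chaos / local equilibrium needed.
* S3 `stub_maxwellisationGap` (XL; local equilibrium in entropy, time-integrated): `|∫∫(H(ρ_r,θ_r) − h_kin)∂ₛφ| ≤ η`
  w.h.p.; `= ∫∫ [KL(h‖M[h]) − (3/2)ρ_r log(1+ϑ²/θ_r)] ∂ₛφ` (the `f_ex` terms CANCEL — no EOS input here).  Intended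
  route (triage r1-1 (2), r1-3 (i); replaces the card's dead fixed-`r` `EvenBudget`): K_N-level free collisional balance
  (`EmpiricalEnskogIdentity`) + `OddContactSymmetry` at `Ψ → F` (truncated, `KineticEnergyTails`) + `RateFloor` +
  entropy-production coercivity of the one-body law (Villani / Toscani–Villani; tree `hardSphereLinearizedOp_spectralGap_holds`
  near equilibrium) ⇒ time-`L¹` Maxwellisation `∫∫ KL(h‖M[h]) = O(r⁴)` pre-shock, `O(r)` post-shock (card
  `production-currency` (ii-a) `EntropicMaxwellisation`); cold spots: temperature floor in measure + `ϑ → 0` after `N → ∞`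
  (ideator 2's `ColdSpotsNegligible`); single-particle balls weigh `O(log N / (N r³))`.
* S4 `stub_entropyFluxGap` (XL; the hidden CUBIC closure): `|∫∫(H u_r − j_kin)·∇φ| ≤ η` w.h.p.;
  `H u_r − j_kin = (H − h_kin)u_r − q_K`, `q_K = ∫(v−u_r) h log h dv = −q_r/(θ_r+ϑ²) + ∫(v−u_r) h log(h/M[h])`: S3 in
  `|u_r|`-weighted form PLUS weak vanishing of the empirical HEAT FLUX `q_r` (third velocity moment) — uniform
  integrability of `|v|³` along the flow (EnergyCurrentTails stmt-9235, unproved; or the mesoscale-rate evasion of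
  card `termwise-even-channel-mesoscale`): where `HighMomentumCutoff(+Narrow)` bites (triage r1-2/r1-3 on exact-ledger T3/N1).
* S5 `stub_initialMatching` (M; honours `localSecondLaw_false_without_lln`): `|∫H(ρ(0),θ(0))φ(0) − ∫h_kin(z)φ(0)| ≤ η`
  w.h.p. under the local Gibbs law — LLN for the kernel-density entropy `h_K` of local Gibbs data at fixed `(r,ϑ)`,
  Maxwellian entropy `∫M log M = ρ log ρ − (3/2)ρ log θ − c₀ρ`, identification of the Euler datum with the LLN profile
  through `TendstoHydroFieldsAt … 0`, and CONTINUITY of `hsExcessFreeEnergy` at the data's densities (Disproof §(d):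
  needed even at equilibrium; = support item HsEosLowDensity stmt-0768 in the band, with `σ₀(profiles)` small).
* S6 `stub_localNetProduction` (THE BET, open-problem depth; one-sided): `P + 𝒲_C ≥ −η` w.h.p. for ALL `τ`.  Given
  S1–S5 it is EQUIVALENT to the crux (tight reduction — triage r1-3 (iii): the line relocates the difficulty into one
  signed collision functional, it does not lower it); pre-shock its content is local equilibration at the Euler rate
  (net `O(Kn)` production `→ 0`, mixture slack `O(r²)` absorbed by `r₀(η)`), post-shock it is "shock layers of
  deterministic spheres produce entropy" (triage r1-1 (S): the smeared statistic has limit `∫₀¹S(α)dα = P_true > 0` on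
  steady shock profiles, Mach 1.2–8).  `𝒲_C` MUST ride with `P`: the kinetic production alone has Euler-order content
  `−σ³∫∫φ ρ² f_ex′ div u` (collisional-transfer work; negative in expansions), paired exactly by the configurational
  entropy change (cards `resibois-offset-identity`, exact-ledger T2: the trace of `EvenStressEnskog` + exact continuity).

## Disproof.lean (cdisprove cycle 1, NO KILL) used

`localSecondLaw_false_without_lln` — the `t = 0` LLN is consumed at S5 and only there (the Euler PDE beyond `t = 0` is
used nowhere, as the file notes); `localSecondLaw_false_without_support` — the support hypothesis is consumed at S1
(boundary term at `s = τ`) and carried by every frame; `not_localSecondLawGapAt` / `not_localSecondLawStrictGap` — every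
stub is TIGHT at global equilibrium (`P → 0`, all gaps `→ 0`; `F ≡ 0` for `G_ϑ ⋆ M_θ = M_{θ+ϑ²}`), no positive gap is
claimed; `not_localSecondLawRAfterN` — the frame is `N → ∞` at FIXED `(r, ϑ)` and S3/S5 genuinely use populated balls
(`N r³ → ∞`; single-particle balls are the `O(log N/(N r³))` error).  §(b) landed lemmas: the line imports
`Theorems/LocalSecondLaw/Negative/Functional` and states everything through its `cone, rhoC, momC, kinC, thetaC, Hs,
entropyFunctional` (defeq to the crux's `let`-tower: the final `change` in `LocalSecondLaw_of`); `Hs_ge`,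
`entropyFunctional_le`, `integral_cone_eq_one`, `hsExcessFreeEnergy_le_two` are the a-priori inputs of S1/S3/S5.  No stub
is an instance of a landed Negative lemma (`FalseWithoutLLN/Support`, `Tightness`, `RAfterN` refute frame changes,
not these statements).  Sibling `Cruxes/OddContactSymmetry/Disproof.lean` §3/§3c (sub-`r` mixtures make `F ≠ 0` at
local equilibrium): met by construction — no `ε⁻¹`-level SPLIT statistic appears anywhere in this skeleton (triage
rock (M)/§1: `EvenBudget`, `RelativeOddBound`, `ProductionBudget` are dead at fixed `r`); only the NET production `P`
and field-level gaps, whose mixture content is `O(r²)`/`O(r⁴)` and absorbed by `r₀(η)`.  Negatives index (12): 9168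
(Euler frame untied to data) — every Euler datum enters through the `t = 0` LLN (S5); 9236/9238 (small cells) —
`N → ∞` before `r, ϑ → 0`; 14607, 13479 not touched.
-/

noncomputable section

open MeasureTheory Set Filter
open scoped ENNReal BigOperators Classical
open Literature.MathematicalPhysics.KineticTheory Literature.Analysis.FluidPDE
open Literature.Analysis.FunctionSpaces (Torus.partialDeriv Torus.IsSmoothSpaceTimeOn)
open Summit.AtomisticToContinuum.HydrodynamicLimit.Theorems.LocalSecondLawNegative
  (cone rhoC momC kinC thetaC Hs entropyFunctional)

namespace Summit.AtomisticToContinuum.HydrodynamicLimit.Cruxes.LocalSecondLaw.KineticSupersolutionKnBudget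

open Summit.AtomisticToContinuum.HydrodynamicLimit.Theses.JParityClosure (LocalSecondLaw)

/-! ## § 0 Objects of the line (all over existing declarations; the crux's pieces are the landed
`LocalSecondLawNegative.{cone, rhoC, momC, kinC, thetaC, Hs, entropyFunctional}`) -/

/-- Phase space of `N + 1` spheres on `𝕋³`. -/
abbrev Cfg (N : ℕ) : Type := Config (N + 1) (Fin 3) T3

/-- Hard-sphere flows of `N + 1` spheres of diameter `σ (N+1)^{-1/3}` on `𝕋³` (the crux's flows). -/
abbrev Flow (σ : ℝ) (N : ℕ) : Type :=
  HardSphereFlow (Torus.geometry (Fin 3)) (hsDiameter σ N) (N + 1)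

variable {N : ℕ}

/-- The `(r, ϑ)`-mollified empirical one-particle law of a configuration,
`h(w)(x₀, v) = (N+1)⁻¹ ∑ᵢ b_r(xᵢ, x₀) G_ϑ(v - vᵢ)` — verbatim the `hm` of `OddContactSymmetry` (stmt-13078):
cone kernel `cone r` in space, Gaussian `localMaxwellian 1 ϑ² v ·` of variance `ϑ²` in velocity.  Its velocity
moments are `(ρ_r, m_r, e_r + (3/2)ϑ²ρ_r)`: temperature `θ_r + ϑ²`. -/
def hm (r ϑ : ℝ) (w : Cfg N) (x₀ : T3) (v : V3) : ℝ :=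
  ∫ q, cone r q.1 x₀ * localMaxwellian 1 (ϑ ^ 2) v q.2 ∂(empiricalMeasure w)

/-- Boltzmann's `H`-density of the mollified law at the field point, `h_K(x₀) = ∫ h log h dv` (a finite Gaussian
mixture: the integral converges; `0` where no particle is within `r` of `x₀`). -/
def hK (r ϑ : ℝ) (w : Cfg N) (x₀ : T3) : ℝ :=
  ∫ v, hm r ϑ w x₀ v * Real.log (hm r ϑ w x₀ v)

/-- The kinetic `H`-flux `j_K(x₀) = ∫ v h log h dv` (convective part `u_r h_K` + conductive part
`q_K = ∫ (v - u_r) h log h`, which carries the empirical heat flux — see S4). -/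
def jK (r ϑ : ℝ) (w : Cfg N) (x₀ : T3) : V3 :=
  ∫ v, (hm r ϑ w x₀ v * Real.log (hm r ϑ w x₀ v)) • v

/-- The configurational (excess) part of the Résibois `H`-density, `g_C = ρ_r f_ex(ρ_r σ³)` — the SAME term as in the
crux's `Hs` (values of the bare-`limsup` EOS only; no derivative is ever taken in this file). -/
def gC (σ r : ℝ) (w : Cfg N) (x₀ : T3) : ℝ :=
  rhoC r w x₀ * hsExcessFreeEnergy (rhoC r w x₀ * σ ^ 3)

/-- The Maxwellian entropy constant `c₀ = (3/2)(1 + log 2π)`: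
`∫ M_{ρ,u,θ} log M_{ρ,u,θ} dv = ρ log ρ - (3/2) ρ log θ - c₀ ρ`. -/
def c0 : ℝ := 3 / 2 * (1 + Real.log (2 * Real.pi))

/-- The Résibois / RET kinetic `H`-density of the mollified empirical law (Resibois1978; Piasecki 1987),
`h_kin = h_K + c₀ ρ_r + ρ_r f_ex(ρ_r σ³)` — the line's comparison ("supersolution") function:
`h_kin - Hs(ρ_r, θ_r) = KL(h ‖ M[h]) - (3/2) ρ_r log(1 + ϑ²/θ_r)` on `{ρ_r > 0, θ_r > 0}` (Gibbs). -/
def hKin (σ r ϑ : ℝ) (w : Cfg N) (x₀ : T3) : ℝ :=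
  hK r ϑ w x₀ + c0 * rhoC r w x₀ + gC σ r w x₀

/-- The empirical velocity `u_r = m_r / ρ_r`, componentwise, with the crux's junk convention `0/0 = 0`
(verbatim the crux's `(mm z s x) k / ρm z s x`). -/
def uC (r : ℝ) (w : Cfg N) (x₀ : T3) (k : Fin 3) : ℝ :=
  (momC r w x₀) k / rhoC r w x₀

/-- The Résibois `H`-flux `j_kin = j_K + (c₀ ρ_r + ρ_r f_ex(ρ_r σ³)) u_r`, componentwise. -/
def jKin (σ r ϑ : ℝ) (w : Cfg N) (x₀ : T3) (k : Fin 3) : ℝ :=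
  (jK r ϑ w x₀) k + (c0 * rhoC r w x₀ + gC σ r w x₀) * uC r w x₀ k

/-- The space–time weak form of `∂ₛ X + div Y` tested against `φ` along the flow, time-`0` term included:
`𝒲[X,Y](z) = ∫₀^τ ∫ (X(Φₛz) ∂ₛφ + ∑ₖ Yₖ(Φₛz) ∂ₖφ) dx ds + ∫ X(z) φ(0,·) dx`
(same `Icc 0 τ`, `deriv`, `Torus.partialDeriv` conventions as the crux's `I`; `Φ₀ z = z` on `Φ.good`). -/
def weakForm {σ : ℝ} (τ : ℝ) (φ : ℝ → T3 → ℝ) (Φ : Flow σ N) (X : Cfg N → T3 → ℝ)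
    (Y : Cfg N → T3 → Fin 3 → ℝ) (z : Cfg N) : ℝ :=
  (∫ s in Icc (0 : ℝ) τ, ∫ x : T3,
      (X (Φ.flow s z) x * deriv (fun s' => φ s' x) s +
        ∑ k : Fin 3, Y (Φ.flow s z) x k * Torus.partialDeriv k (φ s) x)) +
    ∫ x : T3, X z x * φ 0 x

/-- The `φ(s,·)`-localised kinetic `H` of a configuration, `Λ(s, w) = ∫ φ(s,x) h_K(w)(x) dx`. -/
def locH (r ϑ : ℝ) (φ : ℝ → T3 → ℝ) (s : ℝ) (w : Cfg N) : ℝ :=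
  ∫ x : T3, φ s x * hK r ϑ w x

/-- **Kinetic entropy produced at collisions, localised by `φ`** — the SMEARED two-point surprisal jump:
the sum over the collision times `s ∈ (0, τ]` of the trajectory of `z` and the contact pair `i < j`
(`‖sepVec xᵢ xⱼ‖ = ε`; on `Φ.good` exactly one pair is in contact at a collision time,
`IsHardSphereTrajectory.binary`) of `Λ(s, pre) - Λ(s, post)`, the pre-collisional configuration being
`collidePair` of the right-continuous post-collisional one (`reflectVel` is an involution).  To first order in the
two-particle update of `h` each term is the `φ·b_r`-smeared surprisal drop
`(N+1)⁻¹∫φ [b_r(xᵢ,·)(L(·,vᵢ) - L(·,vᵢ')) + b_r(xⱼ,·)(L(·,vⱼ) - L(·,vⱼ'))]` (unprimed = pre, primed = post,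
`L = G_ϑ ⋆ᵥ log h_pre`); the convexity remainder (expanding `h log h` at `h_pre`) is `≤ 0` termwise and
`O(N^{-2/3}(r³ϑ³)⁻¹)` in total (triage r1-3 §5).  Morally `≥ 0` (Boltzmann); at the
Euler scale its limit is the TOTAL kinetic-entropy production incl. the collisional-transfer work. -/
def collisionProduction (σ r ϑ τ : ℝ) (φ : ℝ → T3 → ℝ) (Φ : Flow σ N) (z : Cfg N) : ℝ :=
  ∑ᶠ (s : ℝ) (_ : s ∈ collisionTimes (Torus.geometry (Fin 3)) (hsDiameter σ N)
      (fun t => Φ.flow t z) ∩ Ioc 0 τ),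
    ∑ i : Fin (N + 1), ∑ j : Fin (N + 1),
      (if i < j ∧ ‖(Torus.geometry (Fin 3)).sepVec (Φ.flow s z i).1 (Φ.flow s z j).1‖
            = hsDiameter σ N then
        locH r ϑ φ s (collidePair (Torus.geometry (Fin 3)) i j (Φ.flow s z)) -
          locH r ϑ φ s (Φ.flow s z)
      else 0)

/-- Weak form `𝒲[h_K, j_K]` of the kinetic part. -/
def WK (σ r ϑ τ : ℝ) (φ : ℝ → T3 → ℝ) (Φ : Flow σ N) (z : Cfg N) : ℝ :=
  weakForm τ φ Φ (hK r ϑ) (fun w x k => (jK r ϑ w x) k) z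

/-- Weak form `𝒲_C = 𝒲[g_C, g_C u_r]` of the configurational part transported by the empirical velocity:
`= -∫∫ φ (∂ₛ + div u_r·)(ρ_r f_ex)` weakly, whose smooth-limit value is the compression work `σ³∫∫ φ ρ² f_ex′ div u`
(cards `resibois-offset-identity`, exact-ledger `ConfigurationalWorkIdentity`). -/
def WC (σ r τ : ℝ) (φ : ℝ → T3 → ℝ) (Φ : Flow σ N) (z : Cfg N) : ℝ :=
  weakForm τ φ Φ (gC σ r) (fun w x k => gC σ r w x * uC r w x k) z

/-- **THE BET's functional — localised net entropy production**: kinetic entropy produced at collisions plus the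
configurational weak form (the two must ride together: each alone has signed Euler-order content
`∓σ³∫∫φρ²f_ex′ div u`). -/
def netProduction (σ r ϑ τ : ℝ) (φ : ℝ → T3 → ℝ) (Φ : Flow σ N) (z : Cfg N) : ℝ :=
  collisionProduction σ r ϑ τ φ Φ z + WC σ r τ φ Φ z

/-- The free-flight remainder of the kinetic `H`-balance: on `Φ.good` it equals the streaming commutator of the
velocity mollification, `-ϑ² ∫₀^τ∫∫ φ ∇ᵥlog h · ∇ₓh dv dx ds` (`(∂ₛ + v·∇ₓ)h = -ϑ²∇ᵥ·∇ₓh` between collisions). -/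
def freeFlightRemainder (σ r ϑ τ : ℝ) (φ : ℝ → T3 → ℝ) (Φ : Flow σ N) (z : Cfg N) : ℝ :=
  WK σ r ϑ τ φ Φ z - collisionProduction σ r ϑ τ φ Φ z

/-- The supersolution / Maxwellisation gap paired with `∂ₛφ`: `∫₀^τ ∫ (Hs(ρ_r, θ_r) - h_kin) ∂ₛφ dx ds`
(`= -∫∫ [KL(h‖M[h]) - (3/2)ρ_r log(1+ϑ²/θ_r)] ∂ₛφ` on `{ρ_r, θ_r > 0}`; the `f_ex` terms cancel). -/
def maxwellGap (σ r ϑ τ : ℝ) (φ : ℝ → T3 → ℝ) (Φ : Flow σ N) (z : Cfg N) : ℝ :=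
  ∫ s in Icc (0 : ℝ) τ, ∫ x : T3,
    (Hs σ (rhoC r (Φ.flow s z) x) (thetaC r (Φ.flow s z) x) - hKin σ r ϑ (Φ.flow s z) x) *
      deriv (fun s' => φ s' x) s

/-- The entropy-flux gap paired with `∇φ`: `∫₀^τ ∫ ∑ₖ (Hs(ρ_r,θ_r) u_{r,k} - j_{kin,k}) ∂ₖφ dx ds`
(`Hs u_r - j_kin = (Hs - h_kin) u_r - q_K`, `q_K` the conductive kinetic entropy flux ∋ the empirical heat flux). -/
def fluxGap (σ r ϑ τ : ℝ) (φ : ℝ → T3 → ℝ) (Φ : Flow σ N) (z : Cfg N) : ℝ :=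
  ∫ s in Icc (0 : ℝ) τ, ∫ x : T3,
    ∑ k : Fin 3, (Hs σ (rhoC r (Φ.flow s z) x) (thetaC r (Φ.flow s z) x) * uC r (Φ.flow s z) x k -
      jKin σ r ϑ (Φ.flow s z) x k) * Torus.partialDeriv k (φ s) x

/-- The initial matching term `∫ Hs(ρ_E, θ_E) φ(0,·) - ∫ h_kin(z) φ(0,·)` for comparison fields `ρ_E, θ_E`
(the Euler data at `t = 0` in the composition; a difference of integrals, so S1 needs nothing about `ρ_E, θ_E`). -/
def initialGap (σ r ϑ : ℝ) (φ : ℝ → T3 → ℝ) (ρE θE : T3 → ℝ) (z : Cfg N) : ℝ :=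
  (∫ x : T3, Hs σ (ρE x) (θE x) * φ 0 x) - ∫ x : T3, hKin σ r ϑ z x * φ 0 x

/-! ## § 1 The frames of the line -/

/-- Euler-free in-probability frame: for all local-Gibbs profiles, `σ < σ₀(profiles)`, all flows `Φ`, horizons
`τ > 0` and admissible test functions `φ` (smooth, `≥ 0`, supported in `[0, τ')`, `τ' < τ`), the bad event at
threshold `η` has local-Gibbs probability `≤ δ` in the limit order `N → ∞` at fixed `(r, ϑ)`, then `ϑ → 0`, then
`r → 0` (`∃ r₀ ∀ r ∃ ϑ₀(r) ∀ ϑ ∃ N₀ ∀ N`; the crux's own order with the line's velocity scale `ϑ` inserted). -/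
def EventuallyImprobable
    (bad : (σ r ϑ τ : ℝ) → (φ : ℝ → T3 → ℝ) → (N : ℕ) → Flow σ N → ℝ → Set (Cfg N)) : Prop :=
  ∀ (a₀ θ₀ : T3 → ℝ) (u₀ : T3 → V3), Continuous a₀ → Continuous θ₀ → Continuous u₀ →
    (∀ x, 0 < a₀ x) → (∀ x, 0 < θ₀ x) →
    ∃ σ₀ : ℝ, 0 < σ₀ ∧ ∀ σ : ℝ, 0 < σ → σ < σ₀ →
      ∀ Φ : (N : ℕ) → Flow σ N, ∀ τ : ℝ, 0 < τ →
        ∀ φ : ℝ → T3 → ℝ, Torus.IsSmoothSpaceTimeOn Set.univ φ → (∀ s x, 0 ≤ φ s x) →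
          (∃ τ' : ℝ, τ' < τ ∧ ∀ s, τ' ≤ s → ∀ x, φ s x = 0) →
          ∀ η δ : ℝ, 0 < η → 0 < δ →
            ∃ r₀ : ℝ, 0 < r₀ ∧ ∀ r : ℝ, 0 < r → r < r₀ →
              ∃ ϑ₀ : ℝ, 0 < ϑ₀ ∧ ∀ ϑ : ℝ, 0 < ϑ → ϑ < ϑ₀ →
                ∃ N₀ : ℕ, ∀ N : ℕ, N₀ ≤ N →
                  localGibbsLaw σ a₀ u₀ θ₀ N (Φ N) (bad σ r ϑ τ φ N (Φ N) η) ≤ ENNReal.ofReal δ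

/-- The same frame with the crux's Euler data (classical hs-Euler solution on `[0,T)`, `0 < T`, and the `t = 0` law
of large numbers `TendstoHydroFieldsAt … 0`) in scope; the bad event may use the fields `ρ, θ` (only their
`t = 0` slices are used below). -/
def EventuallyImprobableE
    (bad : (σ r ϑ τ : ℝ) → (φ : ℝ → T3 → ℝ) → (ρ θ : ℝ → T3 → ℝ) → (N : ℕ) → Flow σ N → ℝ →
      Set (Cfg N)) : Prop :=
  ∀ (a₀ θ₀ : T3 → ℝ) (u₀ : T3 → V3), Continuous a₀ → Continuous θ₀ → Continuous u₀ →
    (∀ x, 0 < a₀ x) → (∀ x, 0 < θ₀ x) →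
    ∃ σ₀ : ℝ, 0 < σ₀ ∧ ∀ σ : ℝ, 0 < σ → σ < σ₀ →
      ∀ (T : ℝ) (ρ θ : ℝ → T3 → ℝ) (u : ℝ → T3 → V3), IsHardSphereEulerSolution σ T ρ u θ →
        ∀ Φ : (N : ℕ) → Flow σ N,
          TendstoHydroFieldsAt (fun N => localGibbsLaw σ a₀ u₀ θ₀ N (Φ N)) Φ ρ u θ 0 → 0 < T →
            ∀ τ : ℝ, 0 < τ →
              ∀ φ : ℝ → T3 → ℝ, Torus.IsSmoothSpaceTimeOn Set.univ φ → (∀ s x, 0 ≤ φ s x) →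
                (∃ τ' : ℝ, τ' < τ ∧ ∀ s, τ' ≤ s → ∀ x, φ s x = 0) →
                ∀ η δ : ℝ, 0 < η → 0 < δ →
                  ∃ r₀ : ℝ, 0 < r₀ ∧ ∀ r : ℝ, 0 < r → r < r₀ →
                    ∃ ϑ₀ : ℝ, 0 < ϑ₀ ∧ ∀ ϑ : ℝ, 0 < ϑ → ϑ < ϑ₀ →
                      ∃ N₀ : ℕ, ∀ N : ℕ, N₀ ≤ N →
                        localGibbsLaw σ a₀ u₀ θ₀ N (Φ N) (bad σ r ϑ τ φ ρ θ N (Φ N) η) ≤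
                          ENNReal.ofReal δ

/-- The crux's own bad event read in the line's frame (`ϑ` idle): `{I(z) + ∫ Hs(ρ(0),θ(0)) φ(0) < -η}`, through
the landed `entropyFunctional`/`Hs` (defeq to the crux's `let`-tower). -/
def cruxBad (σ r _ϑ τ : ℝ) (φ : ℝ → T3 → ℝ) (ρ θ : ℝ → T3 → ℝ) (N : ℕ) (Φ : Flow σ N) (η : ℝ) :
    Set (Cfg N) :=
  {z | entropyFunctional σ r τ φ Φ z + ∫ x : T3, Hs σ (ρ 0 x) (θ 0 x) * φ 0 x < -η}

/-! ## § 2 Statements of the six stubs -/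

/-- **S1 statement — the weak-form ledger** (pathwise identity on `Φ.good`; the card's weak-form algebra (3) with
its `EmpiricalHBalance` bookkeeping; provable now, M). -/
def WeakFormLedger : Prop :=
  ∀ (σ r ϑ τ : ℝ), 0 < σ → 0 < r → 0 < ϑ → 0 < τ →
    ∀ φ : ℝ → T3 → ℝ, Torus.IsSmoothSpaceTimeOn Set.univ φ →
      (∃ τ' : ℝ, τ' < τ ∧ ∀ s, τ' ≤ s → ∀ x, φ s x = 0) →
      ∀ (ρE θE : T3 → ℝ) (N : ℕ) (Φ : Flow σ N), ∀ z ∈ Φ.good,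
        entropyFunctional σ r τ φ Φ z + ∫ x : T3, Hs σ (ρE x) (θE x) * φ 0 x =
          netProduction σ r ϑ τ φ Φ z + freeFlightRemainder σ r ϑ τ φ Φ z +
            maxwellGap σ r ϑ τ φ Φ z + fluxGap σ r ϑ τ φ Φ z + initialGap σ r ϑ φ ρE θE z

/-- **S2 statement — the free-flight (commutator) remainder vanishes in probability.** -/
def FreeFlightRemainderVanishes : Prop :=
  EventuallyImprobable fun σ r ϑ τ φ _ Φ η => {z | η < |freeFlightRemainder σ r ϑ τ φ Φ z|}

/-- **S3 statement — the supersolution / Maxwellisation gap vanishes in probability.** -/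
def MaxwellisationGapVanishes : Prop :=
  EventuallyImprobable fun σ r ϑ τ φ _ Φ η => {z | η < |maxwellGap σ r ϑ τ φ Φ z|}

/-- **S4 statement — the entropy-flux (heat-current) gap vanishes in probability.** -/
def EntropyFluxGapVanishes : Prop :=
  EventuallyImprobable fun σ r ϑ τ φ _ Φ η => {z | η < |fluxGap σ r ϑ τ φ Φ z|}

/-- **S5 statement — initial matching through the `t = 0` law of large numbers.** -/
def InitialMatching : Prop :=
  EventuallyImprobableE fun σ r ϑ _ φ ρ θ _ _ η => {z | η < |initialGap σ r ϑ φ (ρ 0) (θ 0) z|}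

/-- **S6 statement — THE BET: localised net entropy production is asymptotically non-negative** (one-sided). -/
def LocalNetProduction : Prop :=
  EventuallyImprobable fun σ r ϑ τ φ _ Φ η => {z | netProduction σ r ϑ τ φ Φ z < -η}

/-! ## § 3 The stubs (registered obligations of the line; `sorry` only here) -/

/-- **S1 · weak-form ledger** (provable now, M).  On `Φ.good`: every space–time integrand below is integrable
along the trajectory (positions continuous, velocities piecewise constant with finitely many jumps on `[0,τ]`,
`hm` a finite Gaussian mixture, `Hs ≥ -1 - e_r` and `-(3/2)ρ_r log θ_r` only log-singular in `x`); the cone fields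
satisfy the EXACT weak continuity equation (`d/ds ∫ b_r(xᵢ+svᵢ, x)φ(x) dx = ∫ b_r(xᵢ, y) vᵢ·∇φ(y+svᵢ) dy` by
translation invariance of `euclidDist` and of Haar measure — only `φ` is differentiated, any `r > 0`), which kills
the `c₀ρ_r` part of `h_kin`; `ρ_r u_{r,k} = m_{r,k}` including the junk branch `ρ_r = 0 ⇒ m_r = 0` (`cone ≥ 0`);
`Φ₀ z = z` on `good`; linearity of the Bochner integral.  The collision sum `P` cancels between `netProduction` and
`freeFlightRemainder`, so S1 is insensitive to its fine print.  Uses the support hypothesis (boundary term at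
`s = τ`: `localSecondLaw_false_without_support`). -/
theorem stub_weakFormLedger : WeakFormLedger := by
  sorry

/-- **S2 · free-flight remainder** (L).  On `Φ.good`, FTC with jumps for `s ↦ Λ(s, Φₛz)` + the Gaussian identity
`(v - vᵢ) G_ϑ(v - vᵢ) = -ϑ² ∇G_ϑ` + IBP in `v` give `𝒲[h_K,j_K] - P = -ϑ²∫₀^τ∫∫ φ ∇ᵥlog h · ∇ₓh` EXACTLY (the card's
`EmpiricalHBalance`, provable now).  Size: (i) mean field `≤ ϑ² √(I_v I_x) = O(ϑ²/(r√θ_*))` wherever the local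
velocity law at scale `r` has spread `≥ √θ_* ≫ ϑ` (`I_v ≲ ρ/θ_*`, `I_x ≲ ρ/r²` for the cone-smoothed law); on a COLD
BEAM (spread `≪ ϑ`) it saturates at `-ϑ²/ϑ_eff² ∫ φ ρ div u = O(1)` — so S2 needs a temperature floor IN MEASURE
(`∫∫ ρ_r 1{θ_r < θ_*} → 0` in probability for some `θ_*(η) > 0`; the in-measure, all-`τ` shadow of
`InvariantGibbsBookkeeping.NoConcentration`), the single dynamical input, shared with S3(b); (ii) sampling
`O((N r⁴ ϑ²)⁻¹)` (diagonal terms `∇(b_rᵢ²)·∇(G_ϑᵢ²)/h`; isolated particles contribute `0` by parity) and velocity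
moments: in expectation under the EVOLVED law by the entropy inequality relative to the invariant Gibbs measure
(relative entropy `O(N)` is conserved ⇒ phase-space pair density at scale `(r,ϑ)` and moments stay bounded) + Markov.
No chaos / local-equilibrium input. -/
theorem stub_freeFlightRemainder : FreeFlightRemainderVanishes := by
  sorry

/-- **S3 · supersolution / Maxwellisation gap** (XL; = local equilibrium in time-`L¹` relative entropy at scale
`r`).  `Hs(ρ_r,θ_r) - h_kin = -KL(h‖M[h]) + (3/2)ρ_r log(1 + ϑ²/θ_r)` on `{ρ_r, θ_r > 0}` (Gibbs' variational
principle; `f_ex` cancels), `= -(ρ_r log ρ_r - 3ρ_r log ϑ + ρ_r f_ex)` on single-velocity balls (`θ_r = 0`: guard, `h = ρ_r G_ϑ`),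
which weigh `O(log N/(N r³))` at fixed `(r, ϑ)`.  Needs, in probability under the evolved law: (a) time-integrated Maxwellisation
`∫∫_{supp φ} KL(h‖M[h]) → O(r⁴)` pre-shock / `O(r)` post-shock as `N → ∞` — intended via the route's K_N-level
chain: free collisional balance (`EmpiricalEnskogIdentity`) + `OddContactSymmetry` at `Ψ → F` (truncation +
`KineticEnergyTails`) ⇒ even production `o(1)`; `RateFloor` ⇒ Boltzmann's `D(h) = o(1)` time-`L¹`;
entropy-production coercivity (Villani 2003 / Toscani–Villani 1999 for the `G_ϑ`-mollified law, constants entering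
through `log` of the local max speed; `hardSphereLinearizedOp_spectralGap_holds` near `M`) ⇒ KL small (card
`production-currency` (ii-a) `EntropicMaxwellisation`; replaces the card's `EvenBudget`, FALSE at fixed `r` by the
mixture rock); (b) cold spots: `∫∫ ρ_r log(1+ϑ²/θ_r) ≤ ϑ²·mass·τ/θ_* + (cold-ball mass) · log`, with a temperature
floor `θ_*` in measure and `ϑ → 0` AFTER `N → ∞` (ideator 2's `ColdSpotsNegligible`).  Two-sided as stated; only
`maxwellGap ≥ -η` is consumed. -/
theorem stub_maxwellisationGap : MaxwellisationGapVanishes := by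
  sorry

/-- **S4 · entropy-flux gap — the hidden cubic closure** (XL).  `Hs u_r - j_kin = (Hs - h_kin) u_r - q_K` with
`q_K = ∫(v - u_r) h log h dv = -q_r/(θ_r + ϑ²) + ∫ (v - u_r) h log(h/M[h]) dv`, `q_r = ½∫(v-u_r)|v-u_r|² h` the
empirical HEAT FLUX at scale `(r,ϑ)`.  Needs S3 in `|u_r|`-weighted form (kinetic-energy weights) AND the weak
vanishing of `∫∫ ∇φ · q_r/θ̃`: uniform integrability of `|v|³` along the flow (EnergyCurrentTails stmt-9235,
UNPROVED, the honest cubic input; or the mesoscale-rate evasion of card `termwise-even-channel-mesoscale`: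
Maxwellisation at rate `Kn^{1/(1+ε)}` + a polynomial 6th-moment bound) + local equilibrium for `q → 0` pre-shock
(`q = O(Kn)`), shock layers of volume `O(Kn)` post-shock.  This is where `HighMomentumCutoff(+Narrow)` bites the
crux (triage: exact-ledger's `c/V³` stream shows a weak cubic closure is NECESSARY for 13081). -/
theorem stub_entropyFluxGap : EntropyFluxGapVanishes := by
  sorry

/-- **S5 · initial matching** (M; the ONLY consumer of the `t = 0` LLN — `localSecondLaw_false_without_lln`).
Under `localGibbsLaw` (positions Gibbs at activity `a₀`, velocities independent local Maxwellians) the kernel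
density `h(z)(x,·) → b_r ⋆ₓ (ρ₀ M_{u₀,θ₀}) ⋆ᵥ G_ϑ` with `∫ h log h dv` converging in `L¹(dx)` in probability
(LLN at fixed `(r,ϑ)`, populated balls `N r³ → ∞`, uniform integrability from velocity moments); then
`h_kin → ρ₀ log ρ₀ - (3/2)ρ₀ log θ₀ + ρ₀ f_ex(ρ₀σ³) = Hs(ρ₀,θ₀)` as `ϑ, r → 0` by `∫M log M = ρ log ρ - (3/2)ρ log θ
- c₀ρ` and CONTINUITY of `hsExcessFreeEnergy` at `ρ₀(x)σ³` (Disproof §(d); support item HsEosLowDensity stmt-0768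
in the band `ρ₀σ³ < η₀`, whence the stub's own `σ₀(profiles)`); finally `(ρ₀, θ₀-profile) = (ρ(0,·), θ(0,·))`
because both are LLN limits of the same fields (`TendstoHydroFieldsAt … 0` + the local-Gibbs statics LLN,
`HardSphereEulerLLN`; continuity from `IsHardSphereEulerSolution` at `t = 0 < T`). -/
theorem stub_initialMatching : InitialMatching := by
  sorry

/-- **S6 · THE BET — localised empirical `H`-theorem at order `Kn`** (open-problem depth; one-sided; all `τ`).
`P + 𝒲_C ≥ -η` w.h.p.: the kinetic entropy produced at the collisions of the deterministic flow, read on the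
`(r,ϑ)`-mollified empirical law and localised by `φ ≥ 0`, plus the configurational entropy change, is
asymptotically non-negative.  By S1–S5 this is EQUIVALENT to the crux (tight reduction): pre-shock its content is
local equilibration at the Euler rate (the net is `O(Kn) → 0`; the fixed-`r` mixture term is `O(r²)` of either
sign, absorbed by `r₀(η)` — triage r1-2/r1-3), post-shock it is the sign of the `O(1)` entropy production of shock
layers, for which the smeared statistic has the right limit (`∫₀¹ S(α) dα = P_true > 0` on steady shock profiles,
triage r1-1 (S), `toy/shock_reference_quad.py`, kit j011545).  Mechanisms on file for the two regimes: near
equilibrium, the pointwise split `F = ½F(1-e^{-F}) + ½F(1+e^{-F})` at the MESOSCALE `N^{-2/9}ϑ⁻¹ ≪ r_N ≪ N^{-1/12}`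
(even half `≥ 0` collision by collision; odd half by `OddContactSymmetry`-at-rate / ring-operator form bound
FACT 2 of card `ring-form-bound-signs-production`, re-homed as layer 2 of stmt-14620) — NOT at fixed `r`, where the
split halves diverge like `N^{1/3}r⁴` (rock); far from equilibrium nothing but the bet.  MD proxy: the one-point
statistic `ε⁻¹K_N[φF]` (card toys j009307/j009995: relaxation-window net `+1.1…+1.5 ± 0.4` per particle at
`φ ∈ {0.05,…,0.3}`, `> 7σ`; case B kill-test j010675 pending) equals `P` up to the Résibois offset, whose pairing
with `𝒲_C` is `EvenStressEnskog`'s trace (`Y = (3/2π) f_ex′`) — the foreseen layer-2 split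
`OnePointNetProduction → OffsetPairing → LocalNetProduction`. -/
theorem stub_localNetProduction : LocalNetProduction := by
  sorry

/-! ## § 4 Composition: the stubs imply the crux (kernel-checked; no `sorry` from here on) -/

section Composition

/-- The local Gibbs law does not charge the complement of the flow's good set (it is `liouville.withDensity _`,
and `Φ.measure_compl_good`). -/
theorem localGibbsLaw_compl_good (σ : ℝ) (a₀ θ₀ : T3 → ℝ) (u₀ : T3 → V3) (N : ℕ)
    (Φ : Flow σ N) : localGibbsLaw σ a₀ u₀ θ₀ N Φ (Φ.good)ᶜ = 0 := by
  have hac : localGibbsLaw σ a₀ u₀ θ₀ N Φ ≪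
      liouville (Torus.geometry (Fin 3)) (N + 1) (hsDiameter σ N) :=
    withDensity_absolutelyContinuous _ _
  exact hac Φ.measure_compl_good

/-- Five fifths. -/
theorem ofReal_fifth_sum {δ : ℝ} (hδ : 0 ≤ δ) :
    ENNReal.ofReal (δ / 5) + (ENNReal.ofReal (δ / 5) + (ENNReal.ofReal (δ / 5) +
      (ENNReal.ofReal (δ / 5) + ENNReal.ofReal (δ / 5)))) = ENNReal.ofReal δ := by
  have h5 : 0 ≤ δ / 5 := by positivity
  rw [← ENNReal.ofReal_add h5 h5, ← ENNReal.ofReal_add h5 (by positivity),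
    ← ENNReal.ofReal_add h5 (by positivity), ← ENNReal.ofReal_add h5 (by positivity)]
  congr 1
  ring

/-- If five reals sum to less than `-η`, one of them is below `-η/5`. -/
theorem exists_lt_of_sum_lt {a b c d e η : ℝ} (h : a + b + c + d + e < -η) :
    a < -(η / 5) ∨ b < -(η / 5) ∨ c < -(η / 5) ∨ d < -(η / 5) ∨ e < -(η / 5) := by
  by_contra hcon
  push Not at hcon
  obtain ⟨ha, hb, hc, hd, he⟩ := hcon
  linarith

/-- Sub-additivity over the six-set union used below. -/
theorem measure_union6_le {α : Type*} [MeasurableSpace α] (μ : Measure α)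
    (S A B C D E : Set α) :
    μ (S ∪ (A ∪ (B ∪ (C ∪ (D ∪ E))))) ≤ μ S + (μ A + (μ B + (μ C + (μ D + μ E)))) :=
  (measure_union_le _ _).trans (add_le_add le_rfl ((measure_union_le _ _).trans
    (add_le_add le_rfl ((measure_union_le _ _).trans (add_le_add le_rfl
      ((measure_union_le _ _).trans (add_le_add le_rfl (measure_union_le _ _))))))))

/-- **The reduction** (the card's `LocalSecondLaw_of : S1 → … → S6 → LocalSecondLaw`, in the line's frame):
the six obligations put the crux's own bad event into the frame `EventuallyImprobableE` (with `ϑ` idle).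
Order of choices: `σ₀` = min of the five probabilistic thresholds; each stub is invoked at `(η/5, δ/5)`; `r₀` = min
of the five radii; given `r < r₀` the INTERNAL velocity scale is `ϑ := ½ min ϑ₀⁽ᵏ⁾(r)`; `N₀` = max of the five;
for `N ≥ N₀` the crux event lies (S1 on `Φ.good`, which carries full mass) in `Φ.goodᶜ ∪ ⋃ₖ badₖ`, and
sub-additivity closes. -/
theorem cruxFrame_of_obligations (h₁ : WeakFormLedger) (h₂ : FreeFlightRemainderVanishes)
    (h₃ : MaxwellisationGapVanishes) (h₄ : EntropyFluxGapVanishes) (h₅ : InitialMatching)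
    (h₆ : LocalNetProduction) : EventuallyImprobableE cruxBad := by
  intro a₀ θ₀ u₀ ha hθ hu ha0 hθ0
  obtain ⟨σ₂, hσ₂, H₂⟩ := h₂ a₀ θ₀ u₀ ha hθ hu ha0 hθ0
  obtain ⟨σ₃, hσ₃, H₃⟩ := h₃ a₀ θ₀ u₀ ha hθ hu ha0 hθ0
  obtain ⟨σ₄, hσ₄, H₄⟩ := h₄ a₀ θ₀ u₀ ha hθ hu ha0 hθ0
  obtain ⟨σ₅, hσ₅, H₅⟩ := h₅ a₀ θ₀ u₀ ha hθ hu ha0 hθ0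
  obtain ⟨σ₆, hσ₆, H₆⟩ := h₆ a₀ θ₀ u₀ ha hθ hu ha0 hθ0
  refine ⟨min (min σ₂ σ₃) (min σ₄ (min σ₅ σ₆)), by positivity, ?_⟩
  intro σ hσ hσlt T ρ θ u hE Φ hLLN hT τ hτ φ hφ hφ0 hsupp η δ hη hδ
  have hσ₂' : σ < σ₂ := hσlt.trans_le ((min_le_left _ _).trans (min_le_left _ _))
  have hσ₃' : σ < σ₃ := hσlt.trans_le ((min_le_left _ _).trans (min_le_right _ _))
  have hσ₄' : σ < σ₄ := hσlt.trans_le ((min_le_right _ _).trans (min_le_left _ _))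
  have hσ₅' : σ < σ₅ :=
    hσlt.trans_le ((min_le_right _ _).trans ((min_le_right _ _).trans (min_le_left _ _)))
  have hσ₆' : σ < σ₆ :=
    hσlt.trans_le ((min_le_right _ _).trans ((min_le_right _ _).trans (min_le_right _ _)))
  have hη5 : 0 < η / 5 := by positivity
  have hδ5 : 0 < δ / 5 := by positivity
  obtain ⟨r₂, hr₂, R₂⟩ := H₂ σ hσ hσ₂' Φ τ hτ φ hφ hφ0 hsupp (η / 5) (δ / 5) hη5 hδ5
  obtain ⟨r₃, hr₃, R₃⟩ := H₃ σ hσ hσ₃' Φ τ hτ φ hφ hφ0 hsupp (η / 5) (δ / 5) hη5 hδ5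
  obtain ⟨r₄, hr₄, R₄⟩ := H₄ σ hσ hσ₄' Φ τ hτ φ hφ hφ0 hsupp (η / 5) (δ / 5) hη5 hδ5
  obtain ⟨r₅, hr₅, R₅⟩ :=
    H₅ σ hσ hσ₅' T ρ θ u hE Φ hLLN hT τ hτ φ hφ hφ0 hsupp (η / 5) (δ / 5) hη5 hδ5
  obtain ⟨r₆, hr₆, R₆⟩ := H₆ σ hσ hσ₆' Φ τ hτ φ hφ hφ0 hsupp (η / 5) (δ / 5) hη5 hδ5
  refine ⟨min (min r₂ r₃) (min r₄ (min r₅ r₆)), by positivity, ?_⟩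
  intro r hr hrlt
  have hr₂' : r < r₂ := hrlt.trans_le ((min_le_left _ _).trans (min_le_left _ _))
  have hr₃' : r < r₃ := hrlt.trans_le ((min_le_left _ _).trans (min_le_right _ _))
  have hr₄' : r < r₄ := hrlt.trans_le ((min_le_right _ _).trans (min_le_left _ _))
  have hr₅' : r < r₅ :=
    hrlt.trans_le ((min_le_right _ _).trans ((min_le_right _ _).trans (min_le_left _ _)))
  have hr₆' : r < r₆ :=
    hrlt.trans_le ((min_le_right _ _).trans ((min_le_right _ _).trans (min_le_right _ _)))
  obtain ⟨ϑ₂, hϑ₂, Q₂⟩ := R₂ r hr hr₂'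
  obtain ⟨ϑ₃, hϑ₃, Q₃⟩ := R₃ r hr hr₃'
  obtain ⟨ϑ₄, hϑ₄, Q₄⟩ := R₄ r hr hr₄'
  obtain ⟨ϑ₅, hϑ₅, Q₅⟩ := R₅ r hr hr₅'
  obtain ⟨ϑ₆, hϑ₆, Q₆⟩ := R₆ r hr hr₆'
  -- the crux event does not see `ϑ`: any `ϑ₀` will do for the frame; the line's internal scale is `m / 2`
  refine ⟨1, one_pos, fun _ _ _ => ?_⟩
  set m : ℝ := min (min ϑ₂ ϑ₃) (min ϑ₄ (min ϑ₅ ϑ₆)) with hmdef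
  have hmpos : 0 < m := by positivity
  have hm₂ : m ≤ ϑ₂ := (min_le_left _ _).trans (min_le_left _ _)
  have hm₃ : m ≤ ϑ₃ := (min_le_left _ _).trans (min_le_right _ _)
  have hm₄ : m ≤ ϑ₄ := (min_le_right _ _).trans (min_le_left _ _)
  have hm₅ : m ≤ ϑ₅ := (min_le_right _ _).trans ((min_le_right _ _).trans (min_le_left _ _))
  have hm₆ : m ≤ ϑ₆ := (min_le_right _ _).trans ((min_le_right _ _).trans (min_le_right _ _))
  set ϑ : ℝ := m / 2 with hϑdef
  have hϑpos : 0 < ϑ := by positivity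
  have hϑm : ϑ < m := by rw [hϑdef]; linarith
  obtain ⟨N₂, P₂⟩ := Q₂ ϑ hϑpos (hϑm.trans_le hm₂)
  obtain ⟨N₃, P₃⟩ := Q₃ ϑ hϑpos (hϑm.trans_le hm₃)
  obtain ⟨N₄, P₄⟩ := Q₄ ϑ hϑpos (hϑm.trans_le hm₄)
  obtain ⟨N₅, P₅⟩ := Q₅ ϑ hϑpos (hϑm.trans_le hm₅)
  obtain ⟨N₆, P₆⟩ := Q₆ ϑ hϑpos (hϑm.trans_le hm₆)
  refine ⟨max (max N₂ N₃) (max N₄ (max N₅ N₆)), fun N hN => ?_⟩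
  have hN₂ : N₂ ≤ N := le_trans ((le_max_left _ _).trans (le_max_left _ _)) hN
  have hN₃ : N₃ ≤ N := le_trans ((le_max_right _ _).trans (le_max_left _ _)) hN
  have hN₄ : N₄ ≤ N := le_trans ((le_max_left _ _).trans (le_max_right _ _)) hN
  have hN₅ : N₅ ≤ N :=
    le_trans ((le_max_left _ _).trans ((le_max_right _ _).trans (le_max_right _ _))) hN
  have hN₆ : N₆ ≤ N :=
    le_trans ((le_max_right _ _).trans ((le_max_right _ _).trans (le_max_right _ _))) hN
  have B₂ := P₂ N hN₂
  have B₃ := P₃ N hN₃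
  have B₄ := P₄ N hN₄
  have B₅ := P₅ N hN₅
  have B₆ := P₆ N hN₆
  simp only [] at B₂ B₃ B₄ B₅ B₆
  show localGibbsLaw σ a₀ u₀ θ₀ N (Φ N)
      {z | entropyFunctional σ r τ φ (Φ N) z + ∫ x : T3, Hs σ (ρ 0 x) (θ 0 x) * φ 0 x < -η} ≤
    ENNReal.ofReal δ
  -- the crux event inside the union of the bad events (ledger S1 on the good set)
  have hsub : {z | entropyFunctional σ r τ φ (Φ N) z +
        ∫ x : T3, Hs σ (ρ 0 x) (θ 0 x) * φ 0 x < -η} ⊆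
      (Φ N).goodᶜ ∪ ({z | netProduction σ r ϑ τ φ (Φ N) z < -(η / 5)} ∪
        ({z | η / 5 < |freeFlightRemainder σ r ϑ τ φ (Φ N) z|} ∪
          ({z | η / 5 < |maxwellGap σ r ϑ τ φ (Φ N) z|} ∪
            ({z | η / 5 < |fluxGap σ r ϑ τ φ (Φ N) z|} ∪
              {z | η / 5 < |initialGap σ r ϑ φ (ρ 0) (θ 0) z|})))) := by
    intro z hz
    by_cases hg : z ∈ (Φ N).good
    · right
      have hid := h₁ σ r ϑ τ hσ hr hϑpos hτ φ hφ hsupp (ρ 0) (θ 0) N (Φ N) z hg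
      simp only [Set.mem_setOf_eq] at hz
      rw [hid] at hz
      simp only [Set.mem_union, Set.mem_setOf_eq]
      rcases exists_lt_of_sum_lt hz with h | h | h | h | h
      · exact Or.inl h
      · exact Or.inr (Or.inl (lt_abs.2 (Or.inr (by linarith))))
      · exact Or.inr (Or.inr (Or.inl (lt_abs.2 (Or.inr (by linarith)))))
      · exact Or.inr (Or.inr (Or.inr (Or.inl (lt_abs.2 (Or.inr (by linarith))))))
      · exact Or.inr (Or.inr (Or.inr (Or.inr (lt_abs.2 (Or.inr (by linarith))))))
    · exact Or.inl hg
  calc localGibbsLaw σ a₀ u₀ θ₀ N (Φ N) {z | entropyFunctional σ r τ φ (Φ N) z +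
          ∫ x : T3, Hs σ (ρ 0 x) (θ 0 x) * φ 0 x < -η}
      ≤ localGibbsLaw σ a₀ u₀ θ₀ N (Φ N) ((Φ N).goodᶜ ∪
          ({z | netProduction σ r ϑ τ φ (Φ N) z < -(η / 5)} ∪
            ({z | η / 5 < |freeFlightRemainder σ r ϑ τ φ (Φ N) z|} ∪
              ({z | η / 5 < |maxwellGap σ r ϑ τ φ (Φ N) z|} ∪
                ({z | η / 5 < |fluxGap σ r ϑ τ φ (Φ N) z|} ∪
                  {z | η / 5 < |initialGap σ r ϑ φ (ρ 0) (θ 0) z|}))))) := measure_mono hsub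
    _ ≤ localGibbsLaw σ a₀ u₀ θ₀ N (Φ N) (Φ N).goodᶜ +
          (localGibbsLaw σ a₀ u₀ θ₀ N (Φ N) {z | netProduction σ r ϑ τ φ (Φ N) z < -(η / 5)} +
            (localGibbsLaw σ a₀ u₀ θ₀ N (Φ N)
                {z | η / 5 < |freeFlightRemainder σ r ϑ τ φ (Φ N) z|} +
              (localGibbsLaw σ a₀ u₀ θ₀ N (Φ N) {z | η / 5 < |maxwellGap σ r ϑ τ φ (Φ N) z|} +
                (localGibbsLaw σ a₀ u₀ θ₀ N (Φ N) {z | η / 5 < |fluxGap σ r ϑ τ φ (Φ N) z|} +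
                  localGibbsLaw σ a₀ u₀ θ₀ N (Φ N)
                    {z | η / 5 < |initialGap σ r ϑ φ (ρ 0) (θ 0) z|})))) :=
        measure_union6_le _ _ _ _ _ _ _
    _ ≤ 0 + (ENNReal.ofReal (δ / 5) + (ENNReal.ofReal (δ / 5) + (ENNReal.ofReal (δ / 5) +
          (ENNReal.ofReal (δ / 5) + ENNReal.ofReal (δ / 5))))) := by
        rw [localGibbsLaw_compl_good]
        gcongr
    _ = ENNReal.ofReal δ := by rw [zero_add, ofReal_fifth_sum hδ.le]

/-- **The crux from the stubs** (kernel-checked; concludes `JParityClosure.LocalSecondLaw` BY NAME).  The six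
registered stubs feed `cruxFrame_of_obligations`; the idle velocity scale of the frame is discharged at `ϑ₀/2`, and
the landed `entropyFunctional`/`Hs` are DEFINITIONALLY the crux's `let`-tower (final `change`). -/
theorem LocalSecondLaw_of : LocalSecondLaw := by
  have H := cruxFrame_of_obligations stub_weakFormLedger stub_freeFlightRemainder
    stub_maxwellisationGap stub_entropyFluxGap stub_initialMatching stub_localNetProduction
  intro a₀ θ₀ u₀ ha hθ hu ha0 hθ0
  obtain ⟨σ₀, hσ₀, H₁⟩ := H a₀ θ₀ u₀ ha hθ hu ha0 hθ0
  refine ⟨σ₀, hσ₀, ?_⟩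
  intro σ hσ hσlt T ρ θ u hE Φ hLLN hT τ hτ φ hφ hφ0 hsupp η δ hη hδ
  obtain ⟨r₀, hr₀, H₂⟩ := H₁ σ hσ hσlt T ρ θ u hE Φ hLLN hT τ hτ φ hφ hφ0 hsupp η δ hη hδ
  refine ⟨r₀, hr₀, fun r hr hrlt => ?_⟩
  obtain ⟨ϑ₀, hϑ₀, H₃⟩ := H₂ r hr hrlt
  obtain ⟨N₀, H₄⟩ := H₃ (ϑ₀ / 2) (by positivity) (by linarith)
  refine ⟨N₀, fun N hN => ?_⟩
  have H₅ := H₄ N hN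
  change localGibbsLaw σ a₀ u₀ θ₀ N (Φ N)
      {z | entropyFunctional σ r τ φ (Φ N) z + ∫ x : T3, Hs σ (ρ 0 x) (θ 0 x) * φ 0 x < -η} ≤
    ENNReal.ofReal δ
  exact H₅

end Composition

end Summit.AtomisticToContinuum.HydrodynamicLimit.Cruxes.LocalSecondLaw.KineticSupersolutionKnBudget
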